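import Mathlib
import HarnessLib
import Summits.HubbardSuperconductivity.HubbardSuperconductivity.Theorems.ComplexGFFStiffnessDefs
import Summits.HubbardSuperconductivity.HubbardSuperconductivity.Theorems.ComplexGFFStiffnessHypALocalTwoPointReduction
import Summits.HubbardSuperconductivity.HubbardSuperconductivity.Theorems.ComplexGFFStiffnessHypALocalTwoPointFreeEnergyReduction

/-!
# Crux `HypALocalTwoPoint`, line `gnv` — the registered stub from `FreeEnergyBounds`

Route `route-HubbardSuperconductivity-ComplexGFFStiffness`, crux item stmt-HubbardSuperconductivity-19155,
registered stub `stub_twoPointGivenZ : TwoPointGivenZ`.  Bookkeeping: the named research statement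
`…Theorems.ComplexGFF.FreeEnergyBounds` (`Theorems/ComplexGFFStiffnessDefs`: `N`-uniform first and
second DIFFERENCE bounds of the finite-volume free energy on the `ι`-admissible ball, [ABKM19]
Thm 2.2 `ℓ ≤ 2` complexified) implies `OnePointLipschitz` (`…FreeEnergyReduction`) and hence the stub
(`…Reduction`).  So `stub_twoPointGivenZ := twoPointGivenZ_of_freeEnergyBounds ‹FreeEnergyBounds›`
once `FreeEnergyBounds` is proved.  All proved here; no `sorry`.

## References
* S. Adams, S. Buchholz, R. Kotecký, S. Müller, arXiv:1910.13564, Theorem 2.2, Ch. 4, Ch. 12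
  [AdamsBuchholzKoteckyMuller2019].
-/

noncomputable section

-- `Summit.<Summit>.<Problem>`: single-conjunct summit, the duplicate component is mandated (D-0017).
set_option linter.dupNamespace false

namespace Summit.HubbardSuperconductivity.HubbardSuperconductivity.Theorems.ComplexGFF

/-- **`FreeEnergyBounds → OnePointLipschitz`** (the named form of
`onePointLipschitz_of_freeEnergyBounds`). -/
theorem onePointLipschitz_of_freeEnergyBounds' (h : FreeEnergyBounds) : OnePointLipschitz :=
  onePointLipschitz_of_freeEnergyBounds h

/-- **`FreeEnergyBounds → TwoPointGivenZ`**: the registered stub of the crux `HypALocalTwoPoint`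
follows from the free-energy difference bounds. -/
theorem twoPointGivenZ_of_freeEnergyBounds (h : FreeEnergyBounds) : TwoPointGivenZ :=
  twoPointGivenZ_of_onePointLipschitz (onePointLipschitz_of_freeEnergyBounds h)

end Summit.HubbardSuperconductivity.HubbardSuperconductivity.Theorems.ComplexGFF

end
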